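import Mathlib.GroupTheory.Nilpotent
import Mathlib.GroupTheory.QuotientGroup.Basic
import Mathlib.GroupTheory.FreeGroup.Basic
import Mathlib.Algebra.BigOperators.Group.List.Basic
import Literature.Topology.FourManifolds.GroupTrisections
import HarnessLib
import Summits.SmoothPoincare4.SmoothPoincare4.Theorems.CongruenceShadowsNilpotentShadowsStandardTorsorCalculus
import Summits.SmoothPoincare4.SmoothPoincare4.Theorems.CongruenceShadowsNilpotentShadowsStandardJohnsonClassTwo

/-!
# Level-one glue I: nilpotent basis correction, Johnson values of products, pair products
# (helper for stub `stub_levelOneGlue`)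

Line `saturated-torsor-descent`, crux `CongruenceShadows.NilpotentShadowsStandard`
(item stmt-SmoothPoincare4-14594).  General group theory with `γₖ₊₁ G = (⊤).lowerCentralSeries k`:
* two homomorphisms that agree modulo the centre agree on `γ₂` (`eqOn_lcs_one_of_central`);
  (IA-calculus modulo `γ₃` is imported from the landed `…JohnsonClassTwo`;)
  an endomorphism congruent to the identity modulo `γₖ₊₁` is congruent to the identity modulo
  `γₖ₊₂` on `γ₂` (`apply_mul_inv_mem_lcs_succ`);
* **nilpotent basis correction** in a free group `F`: if `f a ≡ a (mod γ₂ F)` for every free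
  generator `a`, some endomorphism `β` of `F` has `β (f a) ≡ a (mod γ₄ F)` — the elementary
  substitute for the Hopf property of `F ⧸ γ₄ F` (`freeGroup_basis_correction`, registered as
  `helper_glueBasisCorrection`);
* the first Johnson value `x ↦ ψ x · x⁻¹ (mod γ₃)` of a product of integer powers of
  IA-automorphisms (in `MulAut G`) is the product of the powers of the values (`ia_list_prod_zpow`);
* pair products `PP_c(e) = ∏_v ∏_w [v<w] (c v w)^(e v w)` (ordered list products): functoriality,
  additivity for central entries, termwise congruence.  Mathlib only; no definitions.
-/

set_option linter.dupNamespace false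

open Subgroup Literature.Topology.FourManifolds
open scoped commutatorElement

namespace Summit.SmoothPoincare4.SmoothPoincare4.Theorems.NilpotentShadowsStandard.SaturatedTorsorDescent

/-! ## Homomorphisms agreeing modulo the centre -/

section Central

variable {G M : Type*} [Group G] [Group M]

/-- Central factors do not change a commutator. [folklore] -/
theorem commutatorElement_central_mul_eq {a b : M} (ha : a ∈ center M) (hb : b ∈ center M)
    (x y : M) : ⁅a * x, b * y⁆ = ⁅x, y⁆ := by
  -- adapted from the lead folder work/stubs/stub_reachTwo_torsor.lean
  rw [mem_center_iff] at ha hb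
  simp only [commutatorElement_def, mul_inv_rev]
  calc a * x * (b * y) * (x⁻¹ * a⁻¹) * (y⁻¹ * b⁻¹)
      = a * (x * b * y * x⁻¹) * a⁻¹ * (y⁻¹ * b⁻¹) := by group
    _ = (x * b * y * x⁻¹) * (y⁻¹ * b⁻¹) := by rw [← ha (x * b * y * x⁻¹), mul_inv_cancel_right]
    _ = x * (b * (y * x⁻¹ * y⁻¹) * b⁻¹) := by group
    _ = x * (y * x⁻¹ * y⁻¹) := by rw [← hb (y * x⁻¹ * y⁻¹), mul_inv_cancel_right]
    _ = x * y * x⁻¹ * y⁻¹ := by group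

/-- **Two homomorphisms that agree modulo the centre agree on `γ₂`.** [folklore] -/
theorem eqOn_lcs_one_of_central (A B : G →* M) (h : ∀ x, A x * (B x)⁻¹ ∈ center M) {y : G}
    (hy : y ∈ (⊤ : Subgroup G).lowerCentralSeries 1) : A y = B y := by
  have key : ∀ x, A x = (A x * (B x)⁻¹) * B x := fun x => by rw [inv_mul_cancel_right]
  have hy' : y ∈ closure {g : G | ∃ p ∈ (⊤ : Subgroup G).lowerCentralSeries 0,
      ∃ q ∈ (⊤ : Subgroup G), ⁅p, q⁆ = g} := hy
  clear hy
  induction hy' using Subgroup.closure_induction with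
  | mem g hg =>
    obtain ⟨p, -, q, -, rfl⟩ := hg
    rw [map_commutatorElement, map_commutatorElement, key p, key q]
    exact commutatorElement_central_mul_eq (h p) (h q) _ _
  | one => simp
  | mul a b _ _ iha ihb => rw [map_mul, map_mul, iha, ihb]
  | inv a _ ih => rw [map_inv, map_inv, ih]

/-- Elements of `γₖ₊₁` are central modulo `γₖ₊₂`. [folklore] -/
theorem mk_lcs_mem_center {k : ℕ} {l : G} (hl : l ∈ (⊤ : Subgroup G).lowerCentralSeries k) :
    (l : G ⧸ (⊤ : Subgroup G).lowerCentralSeries (k + 1)) ∈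
      center (G ⧸ (⊤ : Subgroup G).lowerCentralSeries (k + 1)) := by
  -- adapted from the lead folder work/stubs/stub_reachTwo_torsor.lean
  rw [mem_center_iff]
  intro q
  obtain ⟨g, rfl⟩ := QuotientGroup.mk_surjective q
  have h1 : (⁅l, g⁆ : G) ∈ (⊤ : Subgroup G).lowerCentralSeries (k + 1) :=
    commutator_mem_commutator hl (mem_top g)
  have h2 : ⁅QuotientGroup.mk' ((⊤ : Subgroup G).lowerCentralSeries (k + 1)) l,
      QuotientGroup.mk' ((⊤ : Subgroup G).lowerCentralSeries (k + 1)) g⁆ = 1 := by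
    rw [← map_commutatorElement, QuotientGroup.mk'_apply, QuotientGroup.eq_one_iff]
    exact h1
  simpa only [QuotientGroup.mk'_apply] using ((commutatorElement_eq_one_iff_mul_comm).1 h2).symm

/-- **An endomorphism congruent to the identity modulo `γₖ₊₁` is congruent to the identity modulo
`γₖ₊₂` on `γ₂`.** [folklore] -/
theorem apply_mul_inv_mem_lcs_succ (κ : G →* G) {k : ℕ}
    (hκ : ∀ x, κ x * x⁻¹ ∈ (⊤ : Subgroup G).lowerCentralSeries k) {y : G}
    (hy : y ∈ (⊤ : Subgroup G).lowerCentralSeries 1) :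
    κ y * y⁻¹ ∈ (⊤ : Subgroup G).lowerCentralSeries (k + 1) := by
  rw [mul_inv_mem_iff_quot]
  have h := eqOn_lcs_one_of_central
    ((QuotientGroup.mk' ((⊤ : Subgroup G).lowerCentralSeries (k + 1))).comp κ)
    (QuotientGroup.mk' ((⊤ : Subgroup G).lowerCentralSeries (k + 1))) (fun x => ?_) hy
  · simpa only [MonoidHom.comp_apply, QuotientGroup.mk'_apply] using h
  · rw [MonoidHom.comp_apply, QuotientGroup.mk'_apply, QuotientGroup.mk'_apply,
      ← QuotientGroup.mk_inv, ← QuotientGroup.mk_mul]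
    exact mk_lcs_mem_center (hκ x)

end Central

/-! ## Nilpotent basis correction in a free group -/

section Free

variable {α : Type*}

/-- An endomorphism of a free group congruent to the identity on the free generators modulo a
normal subgroup is congruent to the identity everywhere. [folklore] -/
theorem freeGroup_apply_mul_inv_mem (σ : FreeGroup α →* FreeGroup α) (N : Subgroup (FreeGroup α))
    [N.Normal] (h : ∀ a, σ (FreeGroup.of a) * (FreeGroup.of a)⁻¹ ∈ N) (x : FreeGroup α) :
    σ x * x⁻¹ ∈ N := by
  have e : (QuotientGroup.mk' N).comp σ = QuotientGroup.mk' N := by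
    ext a
    simpa only [MonoidHom.comp_apply, QuotientGroup.mk'_apply, mul_inv_mem_iff_quot] using h a
  have hx := DFunLike.congr_fun e x
  simp only [MonoidHom.comp_apply, QuotientGroup.mk'_apply] at hx
  exact (mul_inv_mem_iff_quot N _ _).2 hx

/-- **Correction step.** If `σ ≡ id (mod γₖ₊₁)` on a free group (`1 ≤ k`), then for some
endomorphism `κ ≡ id (mod γₖ₊₁)` one has `κ (σ a) ≡ a (mod γₖ₊₂)` on the free generators.
[folklore] -/
theorem freeGroup_correction_step (σ : FreeGroup α →* FreeGroup α) {k : ℕ} (hk : 1 ≤ k)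
    (hσ : ∀ x, σ x * x⁻¹ ∈ (⊤ : Subgroup (FreeGroup α)).lowerCentralSeries k) :
    ∃ κ : FreeGroup α →* FreeGroup α,
      (∀ x, κ x * x⁻¹ ∈ (⊤ : Subgroup (FreeGroup α)).lowerCentralSeries k) ∧
      ∀ a, κ (σ (FreeGroup.of a)) * (FreeGroup.of a)⁻¹ ∈
        (⊤ : Subgroup (FreeGroup α)).lowerCentralSeries (k + 1) := by
  set κ : FreeGroup α →* FreeGroup α :=
    FreeGroup.lift fun a => (σ (FreeGroup.of a) * (FreeGroup.of a)⁻¹)⁻¹ * FreeGroup.of a with hκ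
  have hκa : ∀ a, κ (FreeGroup.of a) = (σ (FreeGroup.of a) * (FreeGroup.of a)⁻¹)⁻¹ * FreeGroup.of a :=
    fun a => by rw [hκ, FreeGroup.lift_apply_of]
  have h1 : ∀ x, κ x * x⁻¹ ∈ (⊤ : Subgroup (FreeGroup α)).lowerCentralSeries k := by
    refine freeGroup_apply_mul_inv_mem κ ((⊤ : Subgroup (FreeGroup α)).lowerCentralSeries k)
      fun a => ?_
    rw [hκa, mul_assoc, mul_inv_cancel, mul_one]
    exact inv_mem (hσ _)
  refine ⟨κ, h1, fun a => ?_⟩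
  have e : σ (FreeGroup.of a) = (σ (FreeGroup.of a) * (FreeGroup.of a)⁻¹) * FreeGroup.of a := by
    rw [inv_mul_cancel_right]
  rw [e, map_mul, hκa,
    show ∀ p q r : FreeGroup α, p * (q⁻¹ * r) * r⁻¹ = p * q⁻¹ from fun p q r => by group]
  exact apply_mul_inv_mem_lcs_succ κ h1 (lcs_antitone hk (hσ _))

/-- **Nilpotent basis correction.** If `f a ≡ a (mod γ₂ F)` for every free generator `a` of the
free group `F`, some endomorphism `β` of `F` has `β (f a) ≡ a (mod γ₄ F)` for all `a`.
[folklore] -/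
theorem freeGroup_basis_correction (f : α → FreeGroup α)
    (hf : ∀ a, f a * (FreeGroup.of a)⁻¹ ∈ (⊤ : Subgroup (FreeGroup α)).lowerCentralSeries 1) :
    ∃ β : FreeGroup α →* FreeGroup α,
      ∀ a, β (f a) * (FreeGroup.of a)⁻¹ ∈ (⊤ : Subgroup (FreeGroup α)).lowerCentralSeries 3 := by
  have h1 : ∀ x, FreeGroup.lift f x * x⁻¹ ∈ (⊤ : Subgroup (FreeGroup α)).lowerCentralSeries 1 :=
    freeGroup_apply_mul_inv_mem _ ((⊤ : Subgroup (FreeGroup α)).lowerCentralSeries 1) fun a => by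
      rw [FreeGroup.lift_apply_of]; exact hf a
  obtain ⟨κ₁, hκ₁, hκ₁'⟩ := freeGroup_correction_step (FreeGroup.lift f) le_rfl h1
  have h2 : ∀ x, (κ₁.comp (FreeGroup.lift f)) x * x⁻¹ ∈
      (⊤ : Subgroup (FreeGroup α)).lowerCentralSeries 2 :=
    freeGroup_apply_mul_inv_mem _ ((⊤ : Subgroup (FreeGroup α)).lowerCentralSeries 2) fun a => by
      simpa using hκ₁' a
  obtain ⟨κ₂, -, hκ₂'⟩ := freeGroup_correction_step (κ₁.comp (FreeGroup.lift f)) (by norm_num) h2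
  exact ⟨κ₂.comp κ₁, fun a => by simpa using hκ₂' a⟩

end Free

/-! ## Johnson values of products of powers of IA-automorphisms -/

section IAProd

variable {G : Type*} [Group G]

/-- Integer powers (in `MulAut G`) of an IA-automorphism are IA, with Johnson value the power of
the value modulo `γ₃`. [folklore] -/
theorem ia_zpow {ψ : G ≃* G} (hψ : ∀ s, ψ s * s⁻¹ ∈ (⊤ : Subgroup G).lowerCentralSeries 1) (n : ℤ) :
    (∀ s, ((ψ : MulAut G) ^ n : MulAut G) s * s⁻¹ ∈ (⊤ : Subgroup G).lowerCentralSeries 1) ∧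
    ∀ x, ((((ψ : MulAut G) ^ n : MulAut G) x * x⁻¹ : G) : G ⧸ (⊤ : Subgroup G).lowerCentralSeries 2) =
      ((ψ x * x⁻¹ : G) : G ⧸ (⊤ : Subgroup G).lowerCentralSeries 2) ^ n := by
  induction n using Int.induction_on with
  | zero =>
    refine ⟨fun s => ?_, fun x => ?_⟩
    · rw [zpow_zero, MulAut.one_apply, mul_inv_cancel]; exact one_mem _
    · rw [zpow_zero, zpow_zero, MulAut.one_apply, mul_inv_cancel, QuotientGroup.mk_one]
  | succ k ih =>
    obtain ⟨ih1, ih2⟩ := ih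
    have e : ∀ s, ((ψ : MulAut G) ^ ((k : ℤ) + 1) : MulAut G) s = ((ψ : MulAut G) ^ (k : ℤ) : MulAut G) (ψ s) :=
      fun s => by rw [zpow_add_one, MulAut.mul_apply]
    refine ⟨fun s => ?_, fun x => ?_⟩
    · rw [e]; exact ia_trans hψ ih1 s
    · rw [e, ia_quot_trans hψ ih1, ih2, zpow_add_one]
  | pred k ih =>
    obtain ⟨ih1, ih2⟩ := ih
    have e : ∀ s, ((ψ : MulAut G) ^ (-(k : ℤ) - 1) : MulAut G) s =
        ((ψ : MulAut G) ^ (-(k : ℤ)) : MulAut G) (ψ.symm s) :=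
      fun s => by rw [zpow_sub_one, MulAut.mul_apply, MulAut.inv_def]
    refine ⟨fun s => ?_, fun x => ?_⟩
    · rw [e]; exact ia_trans (ia_symm hψ) ih1 s
    · rw [e, ia_quot_trans (ia_symm hψ) ih1, ih2, ia_quot_symm hψ, zpow_sub_one]

/-- A (list) product in `MulAut G` of IA-automorphisms is IA, with Johnson value the product of
the values modulo `γ₃`. [folklore] -/
theorem ia_list_prod {ι : Type*} (l : List ι) (Φ : ι → MulAut G)
    (hΦ : ∀ i, ∀ s, Φ i s * s⁻¹ ∈ (⊤ : Subgroup G).lowerCentralSeries 1) :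
    (∀ s, (l.map Φ).prod s * s⁻¹ ∈ (⊤ : Subgroup G).lowerCentralSeries 1) ∧
    ∀ x, (((l.map Φ).prod x * x⁻¹ : G) : G ⧸ (⊤ : Subgroup G).lowerCentralSeries 2) =
      (l.map fun i => ((Φ i x * x⁻¹ : G) : G ⧸ (⊤ : Subgroup G).lowerCentralSeries 2)).prod := by
  induction l with
  | nil =>
    refine ⟨fun s => ?_, fun x => ?_⟩
    · rw [List.map_nil, List.prod_nil, MulAut.one_apply, mul_inv_cancel]; exact one_mem _
    · rw [List.map_nil, List.map_nil, List.prod_nil, List.prod_nil, MulAut.one_apply, mul_inv_cancel,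
        QuotientGroup.mk_one]
  | cons i l ih =>
    obtain ⟨ih1, ih2⟩ := ih
    simp only [List.map_cons, List.prod_cons]
    refine ⟨fun s => ?_, fun x => ?_⟩
    · rw [MulAut.mul_apply]; exact ia_trans ih1 (hΦ i) s
    · rw [MulAut.mul_apply, ia_quot_trans ih1 (hΦ i), ih2]

/-- The product of integer powers of IA-automorphisms `ψᵢ ^ nᵢ` is IA and its Johnson value at
`x` is `∏ (ψᵢ x · x⁻¹) ^ nᵢ` modulo `γ₃`. [folklore] -/
theorem ia_list_prod_zpow {ι : Type*} (l : List ι) (Ψ : ι → G ≃* G) (n : ι → ℤ)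
    (hΨ : ∀ i, ∀ s, Ψ i s * s⁻¹ ∈ (⊤ : Subgroup G).lowerCentralSeries 1) :
    (∀ s, (l.map fun i => ((Ψ i : MulAut G) ^ n i : MulAut G)).prod s * s⁻¹ ∈
      (⊤ : Subgroup G).lowerCentralSeries 1) ∧
    ∀ x, (((l.map fun i => ((Ψ i : MulAut G) ^ n i : MulAut G)).prod x * x⁻¹ : G) :
        G ⧸ (⊤ : Subgroup G).lowerCentralSeries 2) =
      (l.map fun i => ((Ψ i x * x⁻¹ : G) : G ⧸ (⊤ : Subgroup G).lowerCentralSeries 2) ^ n i).prod := by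
  obtain ⟨h1, h2⟩ := ia_list_prod l (fun i => ((Ψ i : MulAut G) ^ n i : MulAut G))
    fun i => (ia_zpow (hΨ i) (n i)).1
  exact ⟨h1, fun x => by rw [h2]; exact congrArg List.prod (List.map_congr_left fun i _ =>
    (ia_zpow (hΨ i) (n i)).2 x)⟩

end IAProd

/-! ## Pair products -/

section PairProducts

variable {G H : Type*} [Group G] [Group H] {n : ℕ}

/-- Pushing a homomorphism through a pair product. [folklore] -/
theorem pp_map (ψ : G →* H) (c : Fin n → Fin n → G) (e : Fin n → Fin n → ℤ) :
    ψ ((List.finRange n).map (fun v => ((List.finRange n).map (fun w =>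
      if v < w then c v w ^ (e v w) else 1)).prod)).prod =
    ((List.finRange n).map (fun v => ((List.finRange n).map (fun w =>
      if v < w then ψ (c v w) ^ (e v w) else 1)).prod)).prod := by
  -- adapted from the landed CongruenceShadowsNilpotentShadowsStandardStubMagnusWittRead (private)
  simp only [map_list_prod, List.map_map, Function.comp_def]
  refine congrArg List.prod (List.map_congr_left fun v _ => congrArg List.prod
    (List.map_congr_left fun w _ => ?_))
  split_ifs <;> simp

/-- Termwise congruent pair products are equal. [folklore] -/
theorem pp_congr (c c' : Fin n → Fin n → G) (e e' : Fin n → Fin n → ℤ)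
    (h : ∀ v w, v < w → c v w ^ (e v w) = c' v w ^ (e' v w)) :
    ((List.finRange n).map (fun v => ((List.finRange n).map (fun w =>
      if v < w then c v w ^ (e v w) else 1)).prod)).prod =
    ((List.finRange n).map (fun v => ((List.finRange n).map (fun w =>
      if v < w then c' v w ^ (e' v w) else 1)).prod)).prod := by
  refine congrArg List.prod (List.map_congr_left fun v _ => congrArg List.prod
    (List.map_congr_left fun w _ => ?_))
  split_ifs with hvw
  · exact h v w hvw
  · rfl

/-- A product of pointwise products splits when the second factors are central. [folklore] -/
theorem prod_map_mul_of_central {ι : Type*} (l : List ι) (f g : ι → G)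
    (hg : ∀ i, g i ∈ center G) :
    (l.map fun i => f i * g i).prod = (l.map f).prod * (l.map g).prod := by
  -- adapted from the landed CongruenceShadowsNilpotentShadowsStandardStubMagnusWittRead (private)
  induction l with
  | nil => simp
  | cons i l ih =>
    have h := mem_center_iff.mp (hg i) (l.map f).prod
    simp only [List.map_cons, List.prod_cons, ih, mul_assoc]
    congr 1
    rw [← mul_assoc, ← h, mul_assoc]

/-- Pair products of central elements are additive in the exponents. [folklore] -/
theorem pp_add (c : Fin n → Fin n → G) (hc : ∀ v w, c v w ∈ center G) (e e' : Fin n → Fin n → ℤ) :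
    ((List.finRange n).map (fun v => ((List.finRange n).map (fun w =>
      if v < w then c v w ^ (e v w + e' v w) else 1)).prod)).prod =
    ((List.finRange n).map (fun v => ((List.finRange n).map (fun w =>
      if v < w then c v w ^ (e v w) else 1)).prod)).prod *
    ((List.finRange n).map (fun v => ((List.finRange n).map (fun w =>
      if v < w then c v w ^ (e' v w) else 1)).prod)).prod := by
  -- adapted from the landed CongruenceShadowsNilpotentShadowsStandardStubMagnusWittRead (private)
  have hcen : ∀ (e : Fin n → Fin n → ℤ) v w, (if v < w then c v w ^ (e v w) else (1 : G)) ∈ center G :=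
    fun e v w => by split_ifs; exacts [zpow_mem (hc v w) _, one_mem _]
  rw [← prod_map_mul_of_central _ _ _ fun v => list_prod_mem (List.forall_mem_map.2 fun w _ => hcen e' v w)]
  refine congrArg List.prod (List.map_congr_left fun v _ => ?_)
  rw [← prod_map_mul_of_central _ _ _ fun w => hcen e' v w]
  refine congrArg List.prod (List.map_congr_left fun w _ => ?_)
  split_ifs; exacts [zpow_add _ _ _, (mul_one _).symm]

end PairProducts

/-! ## Registered helper -/

/-- **Registered helper `helper_glueBasisCorrection`** (sub-goal of the lead's skeleton for crux
stmt-SmoothPoincare4-14594): nilpotent basis correction in `FreeGroup (Fin n)` — if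
`f a ≡ a (mod γ₂)` for all free generators `a`, some endomorphism `β` has `β (f a) ≡ a (mod γ₄)`.
[folklore] -/
theorem helper_glueBasisCorrection : ∀ (n : ℕ) (f : Fin n → FreeGroup (Fin n)), (∀ a : Fin n, f a * (FreeGroup.of a)⁻¹ ∈ (⊤ : Subgroup (FreeGroup (Fin n))).lowerCentralSeries 1) → ∃ β : FreeGroup (Fin n) →* FreeGroup (Fin n), ∀ a : Fin n, β (f a) * (FreeGroup.of a)⁻¹ ∈ (⊤ : Subgroup (FreeGroup (Fin n))).lowerCentralSeries 3 :=
  fun _ f hf => freeGroup_basis_correction f hf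

end Summit.SmoothPoincare4.SmoothPoincare4.Theorems.NilpotentShadowsStandard.SaturatedTorsorDescent
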